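import Literature.NumberTheory.Rogawski1990.AdelicStableClassesProduct
import Literature.NumberTheory.Rogawski1990.LocalTransferCertification
import HarnessLib

/-!
# Regularity localises: `γ` regular ⇒ `γ_v`, `γ ⊗ 1`, and the class representatives `out ⟦γ_v⟧`, `out ⟦γ_∞⟧` are regular; admissibility read at a
# regular rational class (Rogawski (1990), §3.1 p. 19, §14.2 (14.2.1) p. 232)

Topic `NumberTheory/Rogawski1990`; namespaces `Literature.NumberTheory.Automorphic` (§1) and `Literature.NumberTheory.Rogawski1990` (§§2–3); THEOREMS
ONLY (no definition, no instance, no named fact, no `sorry`).  Plumbing for the kit-level Euler lemma of the T1 line (ED 1.19b₁∕c,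
`ComparisonKit.IsPinned.adelicClassOrbitalIntegral_ofLocal_eq_mul_prod`): the pins hand over admissibility ∕ canonicity of the local and archimedean
orbital measure families ON THE REGULAR CLASSES (★ `OrbitalMeasureFamily.IsAdmissibleOn (fun γ => IsRegularElt γ.val)`), while ★ (S)
`UnitaryGroup.exists_finset_adelicClassOrbitalIntegral_ofLocal_eval_eq_mul_prod` wants, at a rational regular `γ`, the triples
`m_v ⟦γ_v⟧ ≠ 0 ∧ SMulInvariantMeasure ∧ IsFiniteMeasureOnCompacts` (`hadm`) and the same at `⟦γ_∞⟧` (`hadmA`).  In between sit the facts that regularity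
(separability of the characteristic polynomial, ★ `IsRegularElt`) passes to `γ_v = γ ⊗ 1 ∈ U(H)(L⁺_v)` and `γ_∞ = γ ⊗ 1 ∈ U(H)(L ⊗ ℝ)` (base change,
★ `IsRegularElt.map`) and to the chosen representatives `out ⟦·⟧` (a class function, ★ `isRegularElt_of_isConj`):

* §1 `OrbitalMeasureFamily.IsAdmissibleOn.at_mk` ∕ `.at_mk_of_isConj` — the accessor at a class `⟦x⟧`.
* §2 `isRegularElt_toLocalGL`, **`isRegularElt_toLocal_toAdelic`**, `isRegularElt_out_mk_local`, **`isRegularElt_out_mk_toLocal_toAdelic`**;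
  the archimedean twins `isRegularElt_cmRationalToArch`, **`isRegularElt_archPart_toAdelic`**, `isRegularElt_iff_of_isConj_arch`, `isRegularElt_out_mk_arch`,
  **`isRegularElt_out_mk_archPart_toAdelic`**.
* §3 **`isAdmissibleOn_at_toLocal_toAdelic`** ∕ **`isAdmissibleOn_at_archPart_toAdelic`** — the `hadm v` ∕ `hadmA` binders of ★ (S), VERBATIM, from
  `IsAdmissibleOn` on the regular classes and a rational regular `γ`.

## References
* J. D. Rogawski, *Automorphic Representations of Unitary Groups in Three Variables*, Ann. of Math. Stud. 123 (1990), §3.1 p. 19, §14.2 (14.2.1)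
  p. 232 [Rogawski1990].
* S. Gelbart, *Automorphic Forms on Adele Groups*, Ann. of Math. Stud. 83 (1975), §10 pp. 154–155 [Gelbart1975].
-/

set_option autoImplicit false

noncomputable section

open MeasureTheory NumberField IsDedekindDomain

/-! ## §1 Admissibility read at a class -/

namespace Literature.NumberTheory.Automorphic

section AdmissibleOnAt

variable {G : Type*} [Group G] [TopologicalSpace G] [∀ γ : G, MeasurableSpace (G ⧸ Subgroup.centralizer ({γ} : Set G))]

/-- **Admissibility AT THE CLASS `⟦x⟧`**: `m.IsAdmissibleOn P` and `P (out ⟦x⟧)` give `m ⟦x⟧ ≠ 0`, `G`-invariance and finiteness on compacta of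
`m ⟦x⟧` — the shape of the `hadm` binders of ★ `UnitaryGroup.exists_finset_adelicClassOrbitalIntegral_ofLocal_eval_eq_mul_prod`.
[cite: Rogawski1990, §14.2 (14.2.1) p. 232] -/
theorem OrbitalMeasureFamily.IsAdmissibleOn.at_mk {P : G → Prop} {m : OrbitalMeasureFamily G} (h : m.IsAdmissibleOn P) (x : G)
    (hx : P (Quotient.out (ConjClasses.mk x))) :
    m (ConjClasses.mk x) ≠ 0 ∧
      SMulInvariantMeasure G (G ⧸ Subgroup.centralizer ({(Quotient.out (ConjClasses.mk x) : G)} : Set G)) (m (ConjClasses.mk x)) ∧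
        IsFiniteMeasureOnCompacts (m (ConjClasses.mk x)) :=
  h _ hx

/-- **Admissibility at `⟦x⟧` for a CLASS FUNCTION `P` with `P x`** (`x ∼ out ⟦x⟧`, ★ `isConj_out_conjClasses_mk`).
[cite: Rogawski1990, §14.2 (14.2.1) p. 232] [cite: Gelbart1975, §10 pp. 154–155] -/
theorem OrbitalMeasureFamily.IsAdmissibleOn.at_mk_of_isConj {P : G → Prop} {m : OrbitalMeasureFamily G} (h : m.IsAdmissibleOn P)
    (hP : ∀ a b : G, IsConj a b → P a → P b) (x : G) (hx : P x) :
    m (ConjClasses.mk x) ≠ 0 ∧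
      SMulInvariantMeasure G (G ⧸ Subgroup.centralizer ({(Quotient.out (ConjClasses.mk x) : G)} : Set G)) (m (ConjClasses.mk x)) ∧
        IsFiniteMeasureOnCompacts (m (ConjClasses.mk x)) :=
  h _ (hP _ _ (Literature.NumberTheory.Rogawski1990.isConj_out_conjClasses_mk x) hx)

end AdmissibleOnAt

end Literature.NumberTheory.Automorphic

/-! ## §2 Regularity passes to `γ_v`, `γ ⊗ 1` and to class representatives -/

namespace Literature.NumberTheory.Rogawski1990

open Literature.NumberTheory.Automorphic

section Generic

variable {F E : Type} [Field F] [Field E] [NumberField E] [Algebra F E] {N : ℕ}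

/-- **`g` regular ⇒ `g_v = g ⊗ 1 ∈ GL_N(E ⊗ F_v)` regular** (★ `toLocalGL`; base change ★ `IsRegularElt.map`). [cite: Rogawski1990, §3.1 p. 19] -/
theorem isRegularElt_toLocalGL {g : GL (Fin N) E} (hg : IsRegularElt g) (v : HeightOneSpectrum (𝓞 F)) :
    IsRegularElt (UnitaryGroup.toLocalGL E v g) :=
  hg.map _

end Generic

section CM

variable (L : Type) [Field L] [NumberField L] [IsCMField L] {N : ℕ} (H : Matrix (Fin N) (Fin N) L)

/-- **`γ` regular ⇒ `γ_v` regular**: the local component at `v` of the diagonal image of a rational regular `γ ∈ U(H)(L⁺)` is regular in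
`GL_N(L ⊗ L⁺_v)` (`γ_v = γ ⊗ 1`, base change twice: `L → 𝔸_L → L ⊗ L⁺_v`). [cite: Rogawski1990, §3.1 p. 19; §14.2 p. 232] -/
theorem isRegularElt_toLocal_toAdelic (γ : (UnitaryGroup.cmDatum L N H).Rational) (hγ : IsRegularElt (γ.val : GL (Fin N) L))
    (v : HeightOneSpectrum (𝓞 ↥(maximalRealSubfield L))) :
    IsRegularElt (((UnitaryGroup.cmDatum L N H).toLocal v ((UnitaryGroup.cmDatum L N H).toAdelic γ)).val :
      GL (Fin N) (UnitaryGroup.LocalRing L v)) :=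
  (hγ.map (algebraMap L (AdeleRing (𝓞 L) L))).map (UnitaryGroup.adeleToLocal L v)

variable {L H} in
/-- **Regularity of the class representative**: `x ∈ U(H)(L⁺_v)` regular ⇒ `out ⟦x⟧` regular (a class function, ★ `isRegularElt_iff_of_isConj_local`).
[cite: Rogawski1990, §14.2 (14.2.1) p. 232] -/
theorem isRegularElt_out_mk_local {v : HeightOneSpectrum (𝓞 ↥(maximalRealSubfield L))} {x : (UnitaryGroup.cmDatum L N H).Local v}
    (hx : IsRegularElt (x.val : GL (Fin N) (UnitaryGroup.LocalRing L v))) :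
    IsRegularElt ((Quotient.out (ConjClasses.mk x)).val : GL (Fin N) (UnitaryGroup.LocalRing L v)) :=
  (isRegularElt_iff_of_isConj_local L H v (isConj_out_conjClasses_mk x)).1 hx

/-- **`out ⟦γ_v⟧` is regular** for a rational regular `γ`. [cite: Rogawski1990, §14.2 (14.2.1) p. 232] -/
theorem isRegularElt_out_mk_toLocal_toAdelic (γ : (UnitaryGroup.cmDatum L N H).Rational) (hγ : IsRegularElt (γ.val : GL (Fin N) L))
    (v : HeightOneSpectrum (𝓞 ↥(maximalRealSubfield L))) :
    IsRegularElt ((Quotient.out (ConjClasses.mk ((UnitaryGroup.cmDatum L N H).toLocal v ((UnitaryGroup.cmDatum L N H).toAdelic γ)))).val :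
      GL (Fin N) (UnitaryGroup.LocalRing L v)) :=
  isRegularElt_out_mk_local (isRegularElt_toLocal_toAdelic L H γ hγ v)

/-- **`γ` regular ⇒ `γ ⊗ 1 ∈ U(H)(L ⊗ ℝ)` regular** (★ `cmRationalToArch`, base change along `mixedEmbedding`). [cite: Rogawski1990, §3.1 p. 19; §14.3 p. 234] -/
theorem isRegularElt_cmRationalToArch (γ : (UnitaryGroup.cmDatum L N H).Rational) (hγ : IsRegularElt (γ.val : GL (Fin N) L)) :
    IsRegularElt ((cmRationalToArch L N H γ).val : GL (Fin N) (mixedEmbedding.mixedSpace L)) :=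
  hγ.map (mixedEmbedding L)

/-- **`γ_∞ = archPart (toAdelic γ)` is regular** for a rational regular `γ` (★ `archPart_cmDatum_toAdelic`). [cite: Rogawski1990, §14.3 p. 234] -/
theorem isRegularElt_archPart_toAdelic (γ : (UnitaryGroup.cmDatum L N H).Rational) (hγ : IsRegularElt (γ.val : GL (Fin N) L)) :
    IsRegularElt ((UnitaryGroup.archPart (↥(maximalRealSubfield L)) L (IsCMField.complexConj L) N H
      ((UnitaryGroup.cmDatum L N H).toAdelic γ)).val : GL (Fin N) (mixedEmbedding.mixedSpace L)) := by
  rw [archPart_cmDatum_toAdelic]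
  exact isRegularElt_cmRationalToArch L H γ hγ

variable {L H} in
/-- Regularity is a class function on `U(H)(L ⊗ ℝ)`: conjugate elements of the archimedean group are conjugate in `GL_N(L ⊗ ℝ)`
(★ `isRegularElt_of_isConj`). [cite: Rogawski1990, §14.3 p. 234] -/
theorem isRegularElt_iff_of_isConj_arch {a a' : UnitaryGroup.arch (↥(maximalRealSubfield L)) L (IsCMField.complexConj L) N H} (h : IsConj a a') :
    IsRegularElt (a.val : GL (Fin N) (mixedEmbedding.mixedSpace L)) ↔ IsRegularElt (a'.val : GL (Fin N) (mixedEmbedding.mixedSpace L)) := by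
  have hGL : IsConj a.val a'.val := (UnitaryGroup.arch (↥(maximalRealSubfield L)) L (IsCMField.complexConj L) N H).subtype.map_isConj h
  exact ⟨isRegularElt_of_isConj hGL, isRegularElt_of_isConj hGL.symm⟩

variable {L H} in
/-- `a ∈ U(H)(L ⊗ ℝ)` regular ⇒ `out ⟦a⟧` regular. [cite: Rogawski1990, §14.3 p. 234] -/
theorem isRegularElt_out_mk_arch {a : UnitaryGroup.arch (↥(maximalRealSubfield L)) L (IsCMField.complexConj L) N H}
    (ha : IsRegularElt (a.val : GL (Fin N) (mixedEmbedding.mixedSpace L))) :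
    IsRegularElt ((Quotient.out (ConjClasses.mk a)).val : GL (Fin N) (mixedEmbedding.mixedSpace L)) :=
  (isRegularElt_iff_of_isConj_arch (isConj_out_conjClasses_mk a)).1 ha

/-- **`out ⟦γ_∞⟧` is regular** for a rational regular `γ`. [cite: Rogawski1990, §14.3 p. 234] -/
theorem isRegularElt_out_mk_archPart_toAdelic (γ : (UnitaryGroup.cmDatum L N H).Rational) (hγ : IsRegularElt (γ.val : GL (Fin N) L)) :
    IsRegularElt ((Quotient.out (ConjClasses.mk (UnitaryGroup.archPart (↥(maximalRealSubfield L)) L (IsCMField.complexConj L) N H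
      ((UnitaryGroup.cmDatum L N H).toAdelic γ)))).val : GL (Fin N) (mixedEmbedding.mixedSpace L)) :=
  isRegularElt_out_mk_arch (isRegularElt_archPart_toAdelic L H γ hγ)

/-! ## §3 The `hadm` ∕ `hadmA` binders of the Euler product from admissibility on the regular classes -/

/-- **`hadm v` of ★ (S)**: a local family admissible on the regular classes of `U(H)(L⁺_v)` is non-zero, invariant and finite on compacta at `⟦γ_v⟧` for
a rational regular `γ`. [cite: Rogawski1990, §14.2 (14.2.1) p. 232] -/
theorem isAdmissibleOn_at_toLocal_toAdelic
    [∀ (v : HeightOneSpectrum (𝓞 ↥(maximalRealSubfield L))) (x : (UnitaryGroup.cmDatum L N H).Local v),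
      MeasurableSpace ((UnitaryGroup.cmDatum L N H).Local v ⧸ Subgroup.centralizer ({x} : Set ((UnitaryGroup.cmDatum L N H).Local v)))]
    {mG : ∀ v : HeightOneSpectrum (𝓞 ↥(maximalRealSubfield L)), OrbitalMeasureFamily ((UnitaryGroup.cmDatum L N H).Local v)}
    (v : HeightOneSpectrum (𝓞 ↥(maximalRealSubfield L)))
    (hadm : (mG v).IsAdmissibleOn fun x => IsRegularElt (x.val : GL (Fin N) (UnitaryGroup.LocalRing L v)))
    (γ : (UnitaryGroup.cmDatum L N H).Rational) (hγ : IsRegularElt (γ.val : GL (Fin N) L)) :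
    mG v (ConjClasses.mk ((UnitaryGroup.cmDatum L N H).toLocal v ((UnitaryGroup.cmDatum L N H).toAdelic γ))) ≠ 0 ∧
      SMulInvariantMeasure ((UnitaryGroup.cmDatum L N H).Local v) _
        (mG v (ConjClasses.mk ((UnitaryGroup.cmDatum L N H).toLocal v ((UnitaryGroup.cmDatum L N H).toAdelic γ)))) ∧
      IsFiniteMeasureOnCompacts (mG v (ConjClasses.mk ((UnitaryGroup.cmDatum L N H).toLocal v ((UnitaryGroup.cmDatum L N H).toAdelic γ)))) :=
  hadm.at_mk _ (isRegularElt_out_mk_toLocal_toAdelic L H γ hγ v)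

/-- **`hadmA` of ★ (S)**: an archimedean family admissible on the regular classes of `U(H)(L ⊗ ℝ)` is non-zero, invariant and finite on compacta at
`⟦γ_∞⟧` for a rational regular `γ`. [cite: Rogawski1990, §14.2 (14.2.1) p. 232; §14.3 p. 234] -/
theorem isAdmissibleOn_at_archPart_toAdelic
    [∀ a : UnitaryGroup.arch (↥(maximalRealSubfield L)) L (IsCMField.complexConj L) N H,
      MeasurableSpace (UnitaryGroup.arch (↥(maximalRealSubfield L)) L (IsCMField.complexConj L) N H ⧸
        Subgroup.centralizer ({a} : Set (UnitaryGroup.arch (↥(maximalRealSubfield L)) L (IsCMField.complexConj L) N H)))]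
    {mGi : OrbitalMeasureFamily (UnitaryGroup.arch (↥(maximalRealSubfield L)) L (IsCMField.complexConj L) N H)}
    (hadmA : mGi.IsAdmissibleOn fun x => IsRegularElt (x.val : GL (Fin N) (mixedEmbedding.mixedSpace L)))
    (γ : (UnitaryGroup.cmDatum L N H).Rational) (hγ : IsRegularElt (γ.val : GL (Fin N) L)) :
    mGi (ConjClasses.mk (UnitaryGroup.archPart (↥(maximalRealSubfield L)) L (IsCMField.complexConj L) N H ((UnitaryGroup.cmDatum L N H).toAdelic γ))) ≠ 0 ∧
      SMulInvariantMeasure (UnitaryGroup.arch (↥(maximalRealSubfield L)) L (IsCMField.complexConj L) N H) _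
        (mGi (ConjClasses.mk (UnitaryGroup.archPart (↥(maximalRealSubfield L)) L (IsCMField.complexConj L) N H ((UnitaryGroup.cmDatum L N H).toAdelic γ)))) ∧
      IsFiniteMeasureOnCompacts
        (mGi (ConjClasses.mk (UnitaryGroup.archPart (↥(maximalRealSubfield L)) L (IsCMField.complexConj L) N H ((UnitaryGroup.cmDatum L N H).toAdelic γ)))) :=
  hadmA.at_mk _ (isRegularElt_out_mk_archPart_toAdelic L H γ hγ)

end CM

end Literature.NumberTheory.Rogawski1990

end
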